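import Summits.QuantumFields.GaugeBoot.StrongCouplingDoublePlaquette
import HarnessLib

/-!
# Strong coupling from the loop equation, III: the `U(N)` plaquette through second order, `⟨ū_P⟩ = β/(2N) + O(β²)` explicitly (gauge-boot, ADDENDUM 22 part D)

HONEST FRAMING (cell `pub-gaugeboot`, page 1 of every file): the venture produces certified bounds
on lattice expectations at stated coupling, gauge group, dimension and torus size; NOT a mass gap,
NOT a continuum limit, NOT a string tension; NOT Yang–Mills-summit-bearing (barriers
`FixedCouplingUltralocality`, `PerturbativeInvisibility`).  An analytic STRONG-COUPLING statement with explicit,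
volume-independent constants, valid for every torus side `L ≥ 2` and every real coupling; informative only for small
`|β|`; `U(N)` is not one of the cell's tables and no number of CERTIFIED.md is touched.

## Content (`U(N)`, `N ≥ 2`, defining representation, torus `(ℤ/L)^d`, `d ≥ 2`, `L ≥ 2`, tree coupling `β`, weight `s = 0`)

Two iterations of the single-link loop equation (Makeenko's strong-coupling iteration, made rigorous at finite `N` by the
bounds `|tr| ≤ N`).  The loop equation of the plaquette `P̃₀` at its first edge reads
`N·E[tr U_P] = (β/2)(N − E[tr U_P²]) − (β/2)·Σ'_{(ν,ε)≠(ν₀,+)} (E[tr hol(P̃₀P̃_{ν,ε})] − E[tr hol(P̃₀P̃_{ν,ε}⁻¹)])`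
(the deformation by `P̃₀⁻¹` is the trivial loop, trace `N`).  Every primed term is a loop reading the edge
`(x + e_μ, ν₀)` exactly once, hence `O(β)` by one more step (`StrongCouplingOneStep`, `StrongCouplingWords`):
`norm_integral_trace_plaqWord_append_uN_le` — `|E[tr hol(P̃₀·q)]| ≤ 2(d−1)|β|` for every closed `q` avoiding that edge.
The doubly-wound plaquette is pinned by the two identities of `StrongCouplingDoublePlaquette`
(`norm_integral_trace_double_uN_le`: `|E[tr U_P²]| ≤ 4(d−1)N²|β|/(N²−1)`).  Result:

* ★★★ `abs_wilsonExpectation_meanPlaquette_sub_uN_le` — for EVERY `L ≥ 2` and EVERY real `β`: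
  **`|⟨ū_P⟩_{β,L} − β/(2N)| ≤ 2(d−1)β²·(1/(N²−1) + (2d−3)/N²)`** — the first strong-coupling coefficient `1/(2N)` of the
  `U(N)` plaquette (`= N²… ` in 't Hooft units: `u = β_std/(2N²) + O(β_std²/N⁴)` with `β = β_std/N`) with an explicit,
  volume-uniform remainder; ADDENDUM 9's "the truncated bootstrap reproduces the strong-coupling expansion" with the constant
  in the `O`.

References: Yu. Makeenko, *Methods of contemporary gauge theory* (2002), Problem 12.7; M. Creutz, *Quarks, gluons and
lattices* (1983) Ch. 10; P. Anderson, M. Kruczenski, Nucl. Phys. B 921 (2017) §2; V. Kazakov, Z. Zheng, arXiv:2203.11360 §2.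
Everything is `[folklore]`.
-/

noncomputable section

open MeasureTheory Filter Topology NormedSpace
open scoped Matrix.Norms.Frobenius Matrix
open Literature.MathematicalPhysics.QuantumFieldTheory Literature.MathematicalPhysics.QuantumLattice
open Summit.QuantumFields.YangMills.Cruxes.CurvatureAmnesia.WardDefect.SchwingerDyson

namespace Summit.QuantumFields.GaugeBoot

namespace StrongCoupling

variable {d L : ℕ} [NeZero L]

/-! ## The `O(β)` pieces -/

section Pieces

variable {N : ℕ}

/-- **One step on a deformed plaquette word, `U(N)`**: for a word `q` read from `x`, closed at `x` and avoiding the edge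
`(x + e_μ, ν₀)`, `‖E[tr hol_x(P̃₀ · q)]‖ ≤ 2(d−1)|β|` (rotate to `x + e_μ`, one loop-equation step at `(x + e_μ, ν₀)`).
[folklore] -/
theorem norm_integral_trace_plaqWord_append_uN_le (hN : 1 ≤ N) (hL : (1 : ZMod L) ≠ 0) (β : ℝ) (x : Site d L)
    {μ ν₀ : Fin d} (hμν₀ : μ ≠ ν₀) {q : Word d} (hq : Word.Avoids x q (x.shift μ, ν₀)) (hqx : Word.endpoint x q = x) :
    ‖∫ U, (unitaryFundamentalRep (Fin N) ℂ (wordHolonomy U x (plaqWord μ ν₀ true ++ q))).trace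
        ∂(wilsonMeasure (d := d) (L := L) (unitaryFundamentalRep (Fin N) ℂ) β)‖ ≤ 2 * ((d : ℝ) - 1) * |β| := by
  simp_rw [trace_wordHolonomy_plaqWord_append _ x μ ν₀ q hqx]
  refine norm_integral_trace_uN_le (d := d) (L := L) hN β (x.shift μ) ν₀ _ (endpoint_rot x μ ν₀ q hqx) fun U => ?_
  have h := sum_splitTerm_rot (unitaryFundamentalRep (Fin N) ℂ) hL 0 x hμν₀ U hq hqx
  rw [zero_div, sub_zero] at h
  exact h

/-- **The doubly-wound plaquette is `O(β)`, `U(N)`** (`N ≥ 2`): `‖E[tr ρ(U_P²)]‖ ≤ 4(d−1)N²|β|/(N²−1)`, from the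
doubly-wound identity `N·b + a = r₂` and the self-spectator identity `N·a + b = r₁` (`|r₂| ≤ 2(d−1)N|β|`,
`|r₁| ≤ 2(d−1)N²|β|`): `b = (N r₂ − r₁)/(N² − 1)`. [folklore] -/
theorem norm_integral_trace_double_uN_le (hN : 2 ≤ N) (hL : (1 : ZMod L) ≠ 0) (β : ℝ) (x : Site d L) {μ ν₀ : Fin d}
    (hμν₀ : μ ≠ ν₀) :
    ‖∫ U, (unitaryFundamentalRep (Fin N) ℂ (wordHolonomy U x (plaqWord μ ν₀ true ++ plaqWord μ ν₀ true))).trace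
        ∂(wilsonMeasure (d := d) (L := L) (unitaryFundamentalRep (Fin N) ℂ) β)‖ ≤
      4 * ((d : ℝ) - 1) * (N : ℝ) ^ 2 * |β| / ((N : ℝ) ^ 2 - 1) := by
  have hNr : ((unitaryFundamentalLatticeRep N).N : ℝ) = N := rfl
  have hNc : ((unitaryFundamentalLatticeRep N).N : ℂ) = N := rfl
  have hN1 : (1 : ℝ) < (N : ℝ) ^ 2 := by
    have : (2 : ℝ) ≤ N := by exact_mod_cast hN
    nlinarith
  have hIa := doublyWound_identity (d := d) (L := L) (unitaryFundamentalLatticeRep N) hL β x hμν₀ 0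
    fun i j => sdPair_unitaryGroup N β x μ x _ _
  have hIb := spectator_self_identity (d := d) (L := L) (unitaryFundamentalLatticeRep N) hL β x hμν₀ 0
    fun i j => sdPair₂_unitaryGroup N β x μ x _ x _ _
  have hR2 := norm_sum_sum_integral_plaqTerm_le (d := d) (L := L) (unitaryFundamentalLatticeRep N) β 0 x μ
    (plaqWord μ ν₀ true ++ plaqWord μ ν₀ true)
  have hR1 := norm_sum_sum_integral_plaqTerm_mul_trace_le (d := d) (L := L) (unitaryFundamentalLatticeRep N) β 0 x μ
    (plaqWord μ ν₀ true) x (plaqWord μ ν₀ true)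
  rw [hNc, mul_zero, zero_div, sub_zero] at hIa hIb
  rw [norm_zero, add_zero, mul_one, hNr] at hR2 hR1
  -- `b (N² − 1) = N·r₂' − r₁'` with `r₂' = −(β/2) S2`, `r₁' = −(β/2) S1`
  have key := congrArg (fun z : ℂ => ‖z‖) (show _ = _ from by linear_combination (N : ℂ) * hIa - hIb :
    (∫ U, ((unitaryFundamentalLatticeRep N).ρ (wordHolonomy U x (plaqWord μ ν₀ true ++ plaqWord μ ν₀ true))).trace
        ∂(wilsonMeasure (d := d) (L := L) (unitaryFundamentalLatticeRep N).ρ β)) * ((N : ℂ) ^ 2 - 1) =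
      (β / 2 : ℂ) * (∑ ν ∈ Finset.univ.erase μ, ∑ ε : Bool,
        ∫ U, plaqTerm (unitaryFundamentalLatticeRep N).ρ 0 x μ U (plaqWord μ ν₀ true) ν ε *
          ((unitaryFundamentalLatticeRep N).ρ (wordHolonomy U x (plaqWord μ ν₀ true))).trace
          ∂(wilsonMeasure (d := d) (L := L) (unitaryFundamentalLatticeRep N).ρ β)) -
      (N : ℂ) * ((β / 2 : ℂ) * ∑ ν ∈ Finset.univ.erase μ, ∑ ε : Bool,
        ∫ U, plaqTerm (unitaryFundamentalLatticeRep N).ρ 0 x μ U (plaqWord μ ν₀ true ++ plaqWord μ ν₀ true) ν ε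
          ∂(wilsonMeasure (d := d) (L := L) (unitaryFundamentalLatticeRep N).ρ β)))
  simp only [norm_mul] at key
  have hβ2 : ‖(β / 2 : ℂ)‖ = |β| / 2 := by
    rw [show (β / 2 : ℂ) = ((β / 2 : ℝ) : ℂ) by push_cast; ring, Complex.norm_real, Real.norm_eq_abs, abs_div, abs_two]
  have hN2C : ‖((N : ℂ) ^ 2 - 1)‖ = (N : ℝ) ^ 2 - 1 := by
    rw [show ((N : ℂ) ^ 2 - 1) = (((N : ℝ) ^ 2 - 1 : ℝ) : ℂ) by push_cast; ring, Complex.norm_real, Real.norm_eq_abs,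
      abs_of_pos (by linarith)]
  rw [hN2C] at key
  have hd1 : (0 : ℝ) ≤ (d : ℝ) - 1 := by
    have : (1 : ℝ) ≤ d := by exact_mod_cast (Fin.pos μ)
    linarith
  rw [le_div_iff₀ (by linarith : (0 : ℝ) < (N : ℝ) ^ 2 - 1)]
  refine key.trans_le ((norm_sub_le _ _).trans ?_)
  rw [norm_mul, norm_mul, norm_mul, hβ2, Complex.norm_natCast]
  have h1 := mul_le_mul_of_nonneg_left hR1 (by positivity : (0 : ℝ) ≤ |β| / 2)
  have h2 := mul_le_mul_of_nonneg_left (mul_le_mul_of_nonneg_left hR2 (by positivity : (0 : ℝ) ≤ |β| / 2))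
    (Nat.cast_nonneg N : (0 : ℝ) ≤ N)
  nlinarith [h1, h2]

end Pieces

/-! ## The second-order statement -/

section Assembly

/-- **Abstract assembly of the two steps.**  If `N·E + (β/2)·Σ_{ν∈A} Σ_ε g(ν,ε) = 0`, the special term is
`g(ν₀,+) = b − N` with `‖b‖ ≤ B_b`, and every other term has `‖g‖ ≤ B`, then
`‖N·E − (β/2)·N‖ ≤ (|β|/2)·(B_b + ((#A − 1) + #A)·B)`. [folklore] -/
theorem norm_sub_le_of_loopEquation {A : Finset (Fin d)} {ν₀ : Fin d} (hν₀ : ν₀ ∈ A) (g : Fin d → Bool → ℂ)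
    {E b : ℂ} {Nc : ℂ} {β B Bb : ℝ} (heq : Nc * E + (β / 2 : ℂ) * ∑ ν ∈ A, ∑ ε : Bool, g ν ε = 0)
    (h0 : g ν₀ true = b - Nc) (hb : ‖b‖ ≤ Bb) (ht : ∀ ν ∈ A.erase ν₀, ‖g ν true‖ ≤ B) (hf : ∀ ν ∈ A, ‖g ν false‖ ≤ B) :
    ‖Nc * E - (β / 2 : ℂ) * Nc‖ ≤ |β| / 2 * (Bb + (((A.card : ℝ) - 1) + A.card) * B) := by
  have hsplit : ∑ ν ∈ A, ∑ ε : Bool, g ν ε = g ν₀ true + (∑ ν ∈ A.erase ν₀, g ν true + ∑ ν ∈ A, g ν false) := by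
    have h1 : ∑ ν ∈ A, ∑ ε : Bool, g ν ε = ∑ ν ∈ A, g ν true + ∑ ν ∈ A, g ν false := by
      rw [← Finset.sum_add_distrib]
      exact Finset.sum_congr rfl fun ν _ => Fintype.sum_bool _
    rw [h1, ← Finset.add_sum_erase _ _ hν₀]
    ring
  have hid : Nc * E - (β / 2 : ℂ) * Nc = -(β / 2 : ℂ) * (b + (∑ ν ∈ A.erase ν₀, g ν true + ∑ ν ∈ A, g ν false)) := by
    rw [hsplit, h0] at heq
    linear_combination heq
  have hβ2 : ‖(β / 2 : ℂ)‖ = |β| / 2 := by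
    rw [show (β / 2 : ℂ) = ((β / 2 : ℝ) : ℂ) by push_cast; ring, Complex.norm_real, Real.norm_eq_abs, abs_div, abs_two]
  have hcard : ((A.erase ν₀).card : ℝ) = (A.card : ℝ) - 1 := by
    rw [Finset.card_erase_of_mem hν₀, Nat.cast_sub (Finset.card_pos.2 ⟨ν₀, hν₀⟩), Nat.cast_one]
  have hR : ‖∑ ν ∈ A.erase ν₀, g ν true + ∑ ν ∈ A, g ν false‖ ≤ (((A.card : ℝ) - 1) + A.card) * B := by
    refine (norm_add_le _ _).trans ?_
    have h1 := (norm_sum_le _ _).trans (Finset.sum_le_sum ht)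
    have h2 := (norm_sum_le _ _).trans (Finset.sum_le_sum hf)
    rw [Finset.sum_const, nsmul_eq_mul, hcard] at h1
    rw [Finset.sum_const, nsmul_eq_mul] at h2
    linarith
  rw [hid, norm_mul, norm_neg, hβ2]
  exact mul_le_mul_of_nonneg_left ((norm_add_le _ _).trans (add_le_add hb hR)) (by positivity)

end Assembly

section Main

variable {N : ℕ}

/-- ★★★ **THE `U(N)` PLAQUETTE AT STRONG COUPLING THROUGH SECOND ORDER.**  For `N ≥ 2`, `d ≥ 2`, every torus side `L ≥ 2`
and EVERY real (tree) coupling `β`: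
`|⟨ū_P⟩_{β,L} − β/(2N)| ≤ 2(d−1)β²·(1/(N²−1) + (2d−3)/N²)`.
Two loop-equation steps with the trivial bounds `|tr| ≤ N`; uniform in the volume. [folklore] -/
theorem abs_wilsonExpectation_meanPlaquette_sub_uN_le (hN : 2 ≤ N) (hL : (1 : ZMod L) ≠ 0) (hd : 2 ≤ d) (β : ℝ) :
    |wilsonExpectation (unitaryFundamentalRep (Fin N) ℂ) β
        (meanPlaquette (d := d) (L := L) (G := Matrix.unitaryGroup (Fin N) ℂ) (unitaryFundamentalRep (Fin N) ℂ)) -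
        β / (2 * N)| ≤
      2 * ((d : ℝ) - 1) * β ^ 2 * (1 / ((N : ℝ) ^ 2 - 1) + (2 * (d : ℝ) - 3) / (N : ℝ) ^ 2) := by
  obtain ⟨μ, ν₀, hμν₀⟩ : ∃ μ ν₀ : Fin d, μ ≠ ν₀ := ⟨⟨0, by omega⟩, ⟨1, by omega⟩, by simp [Fin.ext_iff]⟩
  have hN1 : 1 ≤ N := by omega
  have hN0 : N ≠ 0 := by omega
  have hNpos : (0 : ℝ) < N := by exact_mod_cast Nat.pos_of_ne_zero hN0
  have hN2pos : (0 : ℝ) < (N : ℝ) ^ 2 := by positivity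
  set x : Site d L := fun _ => 0 with hx
  haveI : IsProbabilityMeasure (wilsonMeasure (d := d) (L := L) (unitaryFundamentalRep (Fin N) ℂ) β) :=
    isProbabilityMeasure_wilsonMeasure (d := d) (L := L) _ (unitaryFundamentalLatticeRep N).continuous β
  -- Step 1: the plaquette loop equation (complex form, `s = 0`), restated on the nose
  have hleq := Equipartition.loopEquation_plaqWord (d := d) (L := L) (unitaryFundamentalLatticeRep N) hL β x hμν₀ true 0
    fun i j => sdPair_unitaryGroup N β x μ x _ _
  simp only [integral_plaqTerm_latticeRep (unitaryFundamentalLatticeRep N)] at hleq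
  simp only [unitaryFundamentalLatticeRep_N, unitaryFundamentalLatticeRep_ρ, zero_div, sub_zero, zero_mul] at hleq
  have hleq' : (N : ℂ) * (∫ U, (unitaryFundamentalRep (Fin N) ℂ (wordHolonomy U x (plaqWord μ ν₀ true))).trace
      ∂(wilsonMeasure (d := d) (L := L) (unitaryFundamentalRep (Fin N) ℂ) β)) +
      (β / 2 : ℂ) * ∑ ν ∈ Finset.univ.erase μ, ∑ ε : Bool,
        ((∫ U, (unitaryFundamentalRep (Fin N) ℂ (wordHolonomy U x (plaqWord μ ν₀ true ++ plaqWord μ ν ε))).trace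
            ∂(wilsonMeasure (d := d) (L := L) (unitaryFundamentalRep (Fin N) ℂ) β)) -
          ∫ U, (unitaryFundamentalRep (Fin N) ℂ (wordHolonomy U x (plaqWord μ ν₀ true ++ (plaqWord μ ν ε).reverse))).trace
            ∂(wilsonMeasure (d := d) (L := L) (unitaryFundamentalRep (Fin N) ℂ) β)) = 0 := hleq
  -- the special term: `E[tr hol(P̃₀P̃₀⁻¹)] = N`
  have htriv : ∫ U, (unitaryFundamentalRep (Fin N) ℂ
      (wordHolonomy U x (plaqWord μ ν₀ true ++ (plaqWord μ ν₀ true).reverse))).trace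
        ∂(wilsonMeasure (d := d) (L := L) (unitaryFundamentalRep (Fin N) ℂ) β) = (N : ℂ) := by
    have : ∀ U : GaugeConfig d L (Matrix.unitaryGroup (Fin N) ℂ),
        (unitaryFundamentalRep (Fin N) ℂ (wordHolonomy U x (plaqWord μ ν₀ true ++ (plaqWord μ ν₀ true).reverse))).trace =
          (N : ℂ) := fun U => by
      rw [wordHolonomy_append_reverse, map_one, Matrix.trace_one, Fintype.card_fin]
    simp_rw [this]
    rw [integral_const, probReal_univ, one_smul]
  -- Step 2: the bounds on the pieces
  have hB : ∀ q : Word d, Word.Avoids x q (x.shift μ, ν₀) → Word.endpoint x q = x →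
      ‖∫ U, (unitaryFundamentalRep (Fin N) ℂ (wordHolonomy U x (plaqWord μ ν₀ true ++ q))).trace
        ∂(wilsonMeasure (d := d) (L := L) (unitaryFundamentalRep (Fin N) ℂ) β)‖ ≤ 2 * ((d : ℝ) - 1) * |β| :=
    fun q hq hqx => norm_integral_trace_plaqWord_append_uN_le (d := d) (L := L) hN1 hL β x hμν₀ hq hqx
  have hν₀A : ν₀ ∈ Finset.univ.erase μ := Finset.mem_erase.2 ⟨fun h => hμν₀ h.symm, Finset.mem_univ _⟩
  have hmain := norm_sub_le_of_loopEquation (d := d) hν₀A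
    (fun ν ε => (∫ U, (unitaryFundamentalRep (Fin N) ℂ (wordHolonomy U x (plaqWord μ ν₀ true ++ plaqWord μ ν ε))).trace
        ∂(wilsonMeasure (d := d) (L := L) (unitaryFundamentalRep (Fin N) ℂ) β)) -
      ∫ U, (unitaryFundamentalRep (Fin N) ℂ (wordHolonomy U x (plaqWord μ ν₀ true ++ (plaqWord μ ν ε).reverse))).trace
        ∂(wilsonMeasure (d := d) (L := L) (unitaryFundamentalRep (Fin N) ℂ) β))
    (B := 2 * (2 * ((d : ℝ) - 1) * |β|)) hleq' (by simp only [htriv])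
    (norm_integral_trace_double_uN_le (d := d) (L := L) hN hL β x hμν₀)
    (fun ν hν => by
      obtain ⟨hνν₀, hν'⟩ := Finset.mem_erase.1 hν
      have hμν : μ ≠ ν := fun h => (Finset.mem_erase.1 hν').1 h.symm
      refine (norm_sub_le _ _).trans (add_le_add ?_ ?_ |>.trans_eq (two_mul _).symm)
      · exact hB _ (avoids_plaqWord_true hL x hμν₀ hνν₀) (endpoint_plaqWord x μ ν true)
      · refine hB _ (avoids_plaqWord_true_reverse hL x hμν₀ hνν₀) ?_
        have h := Word.endpoint_reverse x (plaqWord μ ν true)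
        rwa [endpoint_plaqWord] at h)
    (fun ν hν => by
      have hμν : μ ≠ ν := fun h => (Finset.mem_erase.1 hν).1 h.symm
      refine (norm_sub_le _ _).trans (add_le_add ?_ ?_ |>.trans_eq (two_mul _).symm)
      · exact hB _ (avoids_plaqWord_false hL x hμν₀ hμν) (endpoint_plaqWord x μ ν false)
      · refine hB _ (avoids_plaqWord_false_reverse hL x hμν₀ hμν) ?_
        have h := Word.endpoint_reverse x (plaqWord μ ν false)
        rwa [endpoint_plaqWord] at h)
  rw [card_univ_erase_real] at hmain
  -- Step 3: real parts: `Re(E[tr hol P̃₀]) = N·⟨ū_P⟩`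
  have hre := Equipartition.integral_re_trace_plaqWord (d := d) (L := L) (unitaryFundamentalLatticeRep N) β x hμν₀ true
    (by rw [unitaryFundamentalLatticeRep_N]; exact hN0)
  have hre0 := Equipartition.re_integral_eq (unitaryFundamentalLatticeRep N) β
    (continuous_trace_wordHolonomy (unitaryFundamentalLatticeRep N) x (plaqWord μ ν₀ true))
  simp only [unitaryFundamentalLatticeRep_N, unitaryFundamentalLatticeRep_ρ] at hre hre0
  rw [← hre0] at hre
  have hEP : (∫ U, (unitaryFundamentalRep (Fin N) ℂ (wordHolonomy U x (plaqWord μ ν₀ true))).trace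
      ∂(wilsonMeasure (d := d) (L := L) (unitaryFundamentalRep (Fin N) ℂ) β)).re =
      N * wilsonExpectation (unitaryFundamentalRep (Fin N) ℂ) β
        (meanPlaquette (d := d) (L := L) (G := Matrix.unitaryGroup (Fin N) ℂ) (unitaryFundamentalRep (Fin N) ℂ)) := hre
  have hreal : ((N : ℂ) * (∫ U, (unitaryFundamentalRep (Fin N) ℂ (wordHolonomy U x (plaqWord μ ν₀ true))).trace
      ∂(wilsonMeasure (d := d) (L := L) (unitaryFundamentalRep (Fin N) ℂ) β)) - (β / 2 : ℂ) * N).re =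
      (N : ℝ) ^ 2 * (wilsonExpectation (unitaryFundamentalRep (Fin N) ℂ) β
        (meanPlaquette (d := d) (L := L) (G := Matrix.unitaryGroup (Fin N) ℂ) (unitaryFundamentalRep (Fin N) ℂ)) -
          β / (2 * N)) := by
    have e1 : ((N : ℂ) * (∫ U, (unitaryFundamentalRep (Fin N) ℂ (wordHolonomy U x (plaqWord μ ν₀ true))).trace
        ∂(wilsonMeasure (d := d) (L := L) (unitaryFundamentalRep (Fin N) ℂ) β)) - (β / 2 : ℂ) * N).re =
        N * (∫ U, (unitaryFundamentalRep (Fin N) ℂ (wordHolonomy U x (plaqWord μ ν₀ true))).trace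
          ∂(wilsonMeasure (d := d) (L := L) (unitaryFundamentalRep (Fin N) ℂ) β)).re - β / 2 * N := by
      rw [show (β / 2 : ℂ) = ((β / 2 : ℝ) : ℂ) by push_cast; ring]
      simp only [Complex.sub_re, Complex.mul_re, Complex.natCast_re, Complex.natCast_im, Complex.ofReal_re,
        Complex.ofReal_im, mul_zero, sub_zero, zero_mul]
    rw [e1, hEP]
    field_simp
  have hkey := (Complex.abs_re_le_norm _).trans hmain
  rw [hreal, abs_mul, abs_of_pos hN2pos] at hkey
  rw [← sq_abs β]
  refine ((le_div_iff₀' hN2pos).2 hkey).trans (le_of_eq ?_)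
  field_simp
  ring

end Main

end StrongCoupling

end Summit.QuantumFields.GaugeBoot

end
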